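/-
Copyright (c) 2026. All rights reserved.
Released under Apache 2.0 license as described in the file LICENSE.
-/
import Literature.NumberTheory.ComplexMultiplication.DegenerateCMTypesElementaryAbelianPrimeSquareCount
import Literature.AlgebraicGeometry.Pohlmann1968.DegenerateCMTypesElementaryAbelianCMFieldPrimeSquare
import HarnessLib

/-!
# Simple degenerate abelian `p²`-folds for EVERY abelian CM field of degree `2p²`, and the census of the CM types
# of a CM field with Galois group `⟨ρ⟩ × ℤ₃²` (`342 / 144 / 0 / 24 / 2` of rank `10 / 8 / 6 / 4 / 2`)

B. Dodson, *On the Mumford–Tate group of an abelian variety with complex multiplication*, J. Algebra **111**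
(1987) 49–73 [Dodson1987] (held text `paper:doi-10-1016-0021-8693-87-90242-0`, p. 70 = p0022):

> PROPOSITION 4.4. "(2) Suppose `R₀ = ℤ₃²` and weight(`f`) `= 3`. Then … (a) the orbits of order `9` give types
> with rank(`f`) `= 8` and (b) there are twelve `f` in four `ℤ₃²`-orbits of order `3`."
> REMARK 4.5. "As a corollary of the above analysis of Hol(`R₀`)-orbits, and of the existence of solvable CM-fields,
> we obtain the existence of simple Abelian varieties of dimension `n = 18, 27, 36, 54`, and `72` with rank `10`."

Sequel of `DegenerateCMTypesElementaryAbelianCMFieldPrimeSquare` (row g35-#6: CM fields `K` with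
`Gal(K/ℚ) = ⟨ρ⟩ × ℤₚ²` — frame `(τ, κ)`, degeneracy = equidistribution over the cosets of a `ℤₚ ⊂ ℤₚ²`, exceptional
`(p,p)`-classes, the dichotomy) and of the group-level census `DegenerateCMTypesElementaryAbelianPrimeSquareCount`
(row g35-#7).  Same setting and dictionary.

## What is PROVED (theorems only; no definition, no named fact, no `sorry`)

* §1 (group level, every odd `p`) **`exists_primitive_unique_direction`** — AN EXPLICIT PRIMITIVE DEGENERATE TYPE
  of `⟨ρ⟩ × (ℤ/p)²`: rows `r(0) = {1}`, `r(y) = {0}` (`y ≠ 0`), i.e. the `p` points `τ, κ, …, κ^{p−1}` — weight `p`,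
  one point on each coset of `⟨τ⟩`, equidistributed over NO other direction (the slope-`0` counts are `p − 1, 1, …`,
  the slope-`j` counts `0, ≥ 1, …`), stable under no `u ≠ 1` (so, for `p = 3`, a non-collinear weight-`3` triple);
  rank `(p − 1)p + 2`; `exists_primitive_typeRank_eq`.
* §2 **`exists_isPrimitive_not_isNondegenerate`**, **`exists_realisation_exceptional`** (every `K` with
  `Gal(K/ℚ) = ⟨ρ⟩ × ℤₚ²` has a CM type, primitive at every base embedding, of rank `(p − 1)p + 2`, all of whose
  abelian varieties — which exist — are SIMPLE `p²`-folds with a rational `(p,p)`-class outside `Dᵖ ⊗ ℂ`);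
  coordinate-free **`exists_realisation_exceptional_of_isMulCommutative`**: EVERY CM field Galois over `ℚ` with
  COMMUTATIVE group of order `2p²` (cyclic, by the companion `CyclicPrimeSquare.exists_realisation_exceptional`, or
  not) is the CM field of such a simple degenerate `p²`-fold; `exists_realisation_exceptional_eighteen` (`p = 3`:
  a simple `9`-fold of rank `8` with a `(3,3)`-class outside `D³ ⊗ ℂ`).
* §3 (`p = 3`) **`ncard_cmTypeRank_eq_three`** — THE CENSUS for `Gal(K/ℚ) = ⟨ρ⟩ × ℤ₃²`: `512` CM types, `342` of
  rank `10` (= the nondegenerate ones), `144` of rank `8`, `0` of rank `6`, `24` of rank `4`, `2` of rank `2`;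
  **`ncard_weight_three_isPrimitive`** (PROP. 4.4 (2) with its numbers: `72` primitive and `12` non-primitive types
  of weight `3` in the frame); **`ncard_isPrimitive_not_isNondegenerate_eighteen`** (an ABELIAN CM field of degree
  `18` has `54` or `144` primitive degenerate types according as its group is cyclic — `ℚ(ζ₁₉)`, `ℚ(ζ₂₇)` — or not).

HONEST SCOPE.  The Hodge conjecture for these simple degenerate `p²`-folds is NOT asserted: the `(p,p)`-classes are
exhibited, not shown algebraic.  NOT here: explicit non-cyclic fields (`ℚ(√-d, ζ₇ + ζ₇⁻¹, ζ₉ + ζ₉⁻¹)`), the rank-`6`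
types over `G₀ ⊋ ℤ₃²` (Prop. 4.4 (2b), Prop. 4.6), Remark 4.5's dimensions `18, 27, …`.

## References

* [Dodson1987] B. Dodson, J. Algebra 111 (1987) 49–73: §4.1 Prop. 4.1, Prop. 4.4 (2), Remark 4.5; §4.2 Remark 4.7.
* [Hazama2003CyclicCM] F. Hazama, J. Math. Sci. Univ. Tokyo 10 (2003): §5, Rem. 4.10.
* [Kubota1965] T. Kubota, Trans. AMS 118 (1965), §4 Lemma 2.
* [Gordon1999HodgeAVSurvey] B. B. Gordon, *A survey of the Hodge conjecture for abelian varieties*, 9.2.2, 9.4.3.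
* [Shimura1998] G. Shimura, *Abelian varieties with complex multiplication and modular functions*, §6.2 Thm. 3, §8.2 Prop. 26.

## Provenance

Lane `lit-hodgefound` (Track 2, Layer A3/B), seat `lit-hodgefound-p10` generation 35, row g35-#8; neighbours cited by
name, nothing restated: `DegenerateCMTypesElementaryAbelianPrimeSquareCount` (`typeOfRows` dictionary, census),
`DegenerateCMTypesElementaryAbelianCMFieldPrimeSquare` (frame existence, criteria, exceptional classes),
`DegenerateCMTypesCyclicCMFieldPrimeSquare` (the cyclic companion, `ncard_cmType_sep_eq`).
-/

set_option autoImplicit false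

noncomputable section

open scoped BigOperators NumberField IsMulCommutative Classical
open CategoryTheory NumberField

namespace Literature.AlgebraicGeometry.Pohlmann1968

namespace ElemPrimeSquare

open Literature.NumberTheory.ComplexMultiplication
open Literature.NumberTheory.ComplexMultiplication.CyclicCMType
open Literature.NumberTheory.ComplexMultiplication.CyclicCMType.ElemSq

/-! ## §1 Group level: a primitive type of weight `p` equidistributed over the cosets of `⟨τ⟩` only -/

section Example

variable {G : Type*} [CommGroup G] [Fintype G] [DecidableEq G] {p : ℕ} [hp : Fact p.Prime] {ρ τ κ : G}

/-- `(2 : ℤ/p) ≠ 1`, `(1 : ℤ/p) ≠ 0`, `(2 : ℤ/p) ≠ 0` for an odd prime `p`. [folklore] -/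
private theorem two_ne_one_zmod (hp2 : p ≠ 2) : (2 : ZMod p) ≠ 1 ∧ (1 : ZMod p) ≠ 0 ∧ (2 : ZMod p) ≠ 0 := by
  haveI : Fact (1 < p) := ⟨hp.out.one_lt⟩
  refine ⟨fun h => ?_, one_ne_zero, fun h => ?_⟩
  · have : (1 : ZMod p) = 0 := by linear_combination h
    exact one_ne_zero this
  · have : ((2 : ℕ) : ZMod p) = 0 := by exact_mod_cast h
    rw [ZMod.natCast_eq_zero_iff] at this
    exact hp2 ((Nat.prime_dvd_prime_iff_eq hp.out Nat.prime_two).1 this)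

/-- **A PRIMITIVE DEGENERATE TYPE on `⟨ρ⟩ × (ℤ/p)²` for every odd prime `p`**: the type `S₀` with rows
`r(0) = {1}`, `r(y) = {0}` (`y ≠ 0`) — the `p` points `τ, κ, κ², …, κ^{p−1}` of `(ℤ/p)²` and the complementary
points of `ρ(ℤ/p)²` — is a CM type of weight `p`, equidistributed over the cosets of `⟨τ⟩` (one point each) and
over NO other direction, and stable under no `u ≠ 1`; its rank is `(p − 1)p + 2` (for `p = 3`: a weight-`3`
non-collinear triple, rank `8` — Prop. 4.4 (2)(a)). [cite: Dodson1987, Prop. 4.4 (2)(a)] [cite: Kubota1965, §4 Lemma 2] -/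
theorem exists_primitive_unique_direction (hp2 : p ≠ 2) (hτ : orderOf τ = p) (hκ : orderOf κ = p)
    (hτκ : κ ∉ Subgroup.zpowers τ) (hcard : Fintype.card G = 2 * p ^ 2) (hρ1 : ρ ≠ 1) (hρ2 : ρ * ρ = 1) :
    haveI : NeZero p := ⟨hp.out.ne_zero⟩
    ∃ Φ : Finset G, IsCMTypeWith ρ (Φ : Set G) ∧ (∀ u : G, u ≠ 1 → ¬ IsStableUnder Φ u) ∧
      HasConstantRows p p Φ τ κ ∧ (∀ j : ZMod p, ¬ HasConstantRows p p Φ (τ ^ j.val * κ) τ) ∧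
      (Finset.univ.filter fun xy : ZMod p × ZMod p => τ ^ xy.1.val * κ ^ xy.2.val ∈ Φ).card = p ∧
      typeRank G (Φ : Set G) = (p - 1) * p + 2 := by
  haveI : NeZero p := ⟨hp.out.ne_zero⟩
  obtain ⟨h21, h10, h20⟩ := two_ne_one_zmod (p := p) hp2
  set r : ZMod p → Finset (ZMod p) := fun y => if y = 0 then {1} else {0} with hr
  have hr0 : r 0 = {1} := by simp [hr]
  have hrne : ∀ {y : ZMod p}, y ≠ 0 → r y = {0} := fun hy => by simp [hr, hy]
  set Φ : Finset G := typeOfRows p p ρ τ κ r with hΦ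
  have hcard1 : ∀ y : ZMod p, (r y).card = 1 := fun y => by
    by_cases hy : y = 0
    · rw [hy, hr0, Finset.card_singleton]
    · rw [hrne hy, Finset.card_singleton]
  have hcm : IsCMTypeWith ρ (Φ : Set G) := isCMTypeWith_typeOfRows hp2 hτ hκ hτκ hcard hρ1 hρ2 r
  have hrows : rowSet p p Φ τ κ = r := rowSet_typeOfRows hp2 hτ hκ hτκ hcard hρ1 hρ2 r
  -- equidistributed over the cosets of `⟨τ⟩`: one point in each row
  have hR : HasConstantRows p p Φ τ κ := by
    rw [hasConstantRows_iff_card_rowSet, hrows]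
    intro y y'
    rw [hcard1, hcard1]
  -- not `τ`-stable
  have hnτ : ¬ IsStableUnder Φ τ := by
    rw [isStableUnder_iff_rowSet hp2 hτ hκ hτκ hcard hcm, hrows]
    intro H
    have := (H 1 0).1 (by rw [hr0]; exact Finset.mem_singleton_self _)
    rw [hr0, Finset.mem_singleton] at this
    exact h21 (by rw [← this]; norm_num)
  -- not `τʲκ`-stable
  have h12 : (1 : ZMod p) + 1 = 2 := by norm_num
  have hnj : ∀ j : ZMod p, ¬ IsStableUnder Φ (τ ^ j.val * κ) := by
    intro j H
    rw [isStableUnder_diag_iff_rowSet hp2 hτ hκ hτκ hcard hcm j, hrows] at H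
    have h1 := (H 1 0).1 (by rw [hr0]; exact Finset.mem_singleton_self _)
    rw [zero_add, hrne h10, Finset.mem_singleton] at h1
    have h2 := (H 0 1).1 (by rw [hrne h10]; exact Finset.mem_singleton_self _)
    rw [zero_add, h12, hrne h20, Finset.mem_singleton] at h2
    rw [h2, add_zero] at h1
    exact h10 h1
  have hprim : ∀ u : G, u ≠ 1 → ¬ IsStableUnder Φ u :=
    (forall_not_isStableUnder_iff hp2 hτ hκ hτκ hcard hcm).2 ⟨hnτ, hnj⟩
  -- no diagonal direction is equidistributed
  have hnR : ∀ j : ZMod p, ¬ HasConstantRows p p Φ (τ ^ j.val * κ) τ := by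
    intro j H
    rw [hasConstantRows_diag_iff_rowSet hτ hκ j, hrows] at H
    have e := H 0 1
    by_cases hj : j = 0
    · -- slope `0` (the subgroup `⟨κ⟩`): `#{y : 0 ∈ r y} = p − 1 ≥ 2` but `#{y : 1 ∈ r y} = 1`
      subst hj
      have hle : (Finset.univ.filter fun y : ZMod p => 0 * y + 1 ∈ r y).card ≤ 1 := by
        refine Finset.card_le_one.2 fun a ha b hb => ?_
        rw [Finset.mem_filter, zero_mul, zero_add] at ha hb
        have ha0 : a = 0 := by
          by_contra hne
          rw [hrne hne, Finset.mem_singleton] at ha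
          exact h10 ha.2
        have hb0 : b = 0 := by
          by_contra hne
          rw [hrne hne, Finset.mem_singleton] at hb
          exact h10 hb.2
        rw [ha0, hb0]
      have hge : 2 ≤ (Finset.univ.filter fun y : ZMod p => 0 * y + 0 ∈ r y).card := by
        have hsub : ({1, 2} : Finset (ZMod p)) ⊆ Finset.univ.filter fun y : ZMod p => 0 * y + 0 ∈ r y := by
          intro y hy
          rw [Finset.mem_insert, Finset.mem_singleton] at hy
          rw [Finset.mem_filter, zero_mul, zero_add]
          refine ⟨Finset.mem_univ _, ?_⟩
          rcases hy with rfl | rfl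
          · rw [hrne h10]; exact Finset.mem_singleton_self _
          · rw [hrne h20]; exact Finset.mem_singleton_self _
        have := Finset.card_le_card hsub
        rwa [Finset.card_pair h21.symm] at this
      omega
    · -- slope `j ≠ 0`: `#{y : jy ∈ r y} = 0` but `0 ∈ {y : jy + 1 ∈ r y}`
      have h0 : (Finset.univ.filter fun y : ZMod p => j * y + 0 ∈ r y).card = 0 := by
        rw [Finset.card_eq_zero, Finset.filter_eq_empty_iff]
        intro y _ hy
        rw [add_zero] at hy
        by_cases hy0 : y = 0
        · rw [hy0, mul_zero, hr0, Finset.mem_singleton] at hy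
          exact h10 hy.symm
        · rw [hrne hy0, Finset.mem_singleton, mul_eq_zero] at hy
          exact hy.elim hj hy0
      have hpos : 0 < (Finset.univ.filter fun y : ZMod p => j * y + 1 ∈ r y).card :=
        Finset.card_pos.2 ⟨0, Finset.mem_filter.2 ⟨Finset.mem_univ _, by
          rw [mul_zero, zero_add, hr0]; exact Finset.mem_singleton_self _⟩⟩
      omega
  -- weight `p`
  have hw : (Finset.univ.filter fun xy : ZMod p × ZMod p => τ ^ xy.1.val * κ ^ xy.2.val ∈ Φ).card = p := by
    rw [weight_eq_sum_card_rowSet, hrows, Finset.sum_congr rfl fun y _ => hcard1 y, Finset.sum_const,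
      Finset.card_univ, ZMod.card, smul_eq_mul, mul_one]
  refine ⟨Φ, hcm, hprim, hR, hnR, hw, ?_⟩
  refine typeRank_eq_of_unique_direction hp2 hτ hκ hτκ hcard hcm ?_
  rw [if_pos hR, Finset.filter_false_of_mem fun j _ => hnR j, Finset.card_empty]

/-- **Hence `⟨ρ⟩ × (ℤ/p)²` carries primitive types of rank `(p − 1)p + 2 < p² + 1`** (degenerate primitive types —
simple degenerate abelian `p²`-folds — for the second minimal group too). [cite: Dodson1987, Prop. 4.4 (2)(a) and Remark 4.5] -/
theorem exists_primitive_typeRank_eq (hp2 : p ≠ 2) (hτ : orderOf τ = p) (hκ : orderOf κ = p)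
    (hτκ : κ ∉ Subgroup.zpowers τ) (hcard : Fintype.card G = 2 * p ^ 2) (hρ1 : ρ ≠ 1) (hρ2 : ρ * ρ = 1) :
    ∃ Φ : Finset G, IsCMTypeWith ρ (Φ : Set G) ∧ (∀ u : G, u ≠ 1 → ¬ IsStableUnder Φ u) ∧
      typeRank G (Φ : Set G) = (p - 1) * p + 2 ∧ typeRank G (Φ : Set G) ≠ p ^ 2 + 1 := by
  obtain ⟨Φ, hcm, hprim, -, -, -, hrank⟩ := exists_primitive_unique_direction hp2 hτ hκ hτκ hcard hρ1 hρ2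
  refine ⟨Φ, hcm, hprim, hrank, ?_⟩
  rw [hrank]
  have hlt : (p - 1) * p + 2 < p ^ 2 + 1 := by
    obtain ⟨k, rfl⟩ := Nat.exists_eq_add_of_le hp.out.one_lt.le
    rw [Nat.add_sub_cancel_left]
    have hk : 1 ≤ k := by have := hp.out.two_le; omega
    nlinarith
  exact hlt.ne

end Example

/-! ## §2 Simple degenerate abelian `p²`-folds with CM by `K`, `Gal(K/ℚ) = ⟨ρ⟩ × ℤₚ²` -/

open Literature.AlgebraicGeometry.Motives (AbelianVariety CMType)
open Literature.AlgebraicGeometry.HodgeTheory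
open Literature.AlgebraicGeometry.ComplexMultiplication (IsCMTypeRealisation isSimple_iff_isPrimitive
  exists_isCMTypeRealisation)
open Literature.Barriers.HodgeConjecture (divisorClassesSpan)
open Literature.AlgebraicGeometry.Pohlmann1968.CyclicTwoOddPrimes (isCMTypeWith_galType
  cmTypeRank_eq_typeRank_galType exists_cmType_of_isCMTypeWith)
open Literature.AlgebraicGeometry.Pohlmann1968.CyclicPrimeSquare (card_gal_eq finrank_div_two_eq dim_eq
  ncard_cmType_sep_eq)

section Existence

variable {K : Type} [Field K] [NumberField K] [IsCMField K] [Normal ℚ K] [IsMulCommutative (K ≃ₐ[ℚ] K)]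
variable {p : ℕ} [hp : Fact p.Prime] {ρ τ κ : K ≃ₐ[ℚ] K} {φ₀ : K →+* ℂ}

/-- **Every CM field with Galois group `⟨ρ⟩ × ℤₚ²` carries PRIMITIVE DEGENERATE CM types**: a CM type `Φ` of `K`,
primitive at every base embedding, of Kubota rank `(p − 1)p + 2`, all of whose abelian varieties are SIMPLE
`p²`-folds with a rational `(p,p)`-class outside `Dᵖ ⊗ ℂ`. [cite: Dodson1987, Prop. 4.4 (2)(a) and Remark 4.5]
[cite: Hazama2003CyclicCM, Rem. 4.10] [cite: Gordon1999HodgeAVSurvey, 9.2.2] -/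
theorem exists_isPrimitive_not_isNondegenerate (hp2 : p ≠ 2) (hρ : ∀ x, φ₀ (ρ x) = starRingEnd ℂ (φ₀ x))
    (hτ : orderOf τ = p) (hκ : orderOf κ = p) (hτκ : κ ∉ Subgroup.zpowers τ)
    (hK : Module.finrank ℚ K = 2 * p ^ 2) :
    ∃ Φ : CMType K, (∀ φh : K →+* ℂ, IsPrimitive (ℂ ≃+* ℂ) Φ.1 φh) ∧ ¬ IsNondegenerate Φ ∧
      cmTypeRank Φ = (p - 1) * p + 2 ∧
      ∀ (A : AbelianVariety ℂ) (ι : 𝓞 K →+* End A) (θ : K →+* Module.End ℂ (complexBetti A.X 1)),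
        IsCMTypeRealisation Φ A ι θ →
          A.IsSimple ∧ A.dim = p ^ 2 ∧
            ∃ c : complexBetti A.X (2 * p), IsRationalClass c ∧ IsOfHodgeType (p ^ 2) A.X (2 * p) p p c ∧
              c ∉ divisorClassesSpan A.X (p ^ 2) p := by
  haveI : NeZero p := ⟨hp.out.ne_zero⟩
  have hcardG := card_gal_eq φ₀ hK
  have hρ1 := conjGalElt_ne_one hρ
  have hρ2 := conjGalElt_mul_self hρ
  obtain ⟨ΦG, hcm, hprimG, hrG, -, -, hrankG⟩ :=
    exists_primitive_unique_direction hp2 hτ hκ hτκ hcardG hρ1 hρ2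
  obtain ⟨Φ, hΦ⟩ := exists_cmType_of_isCMTypeWith (φ₀ := φ₀) hρ hcm
  have hprim' : ∀ u : K ≃ₐ[ℚ] K, u ≠ 1 →
      ¬ IsStableUnder (Finset.univ.filter fun g : K ≃ₐ[ℚ] K => embOf φ₀ g ∈ Φ.1) u := by rw [hΦ]; exact hprimG
  have hr' : HasConstantRows p p (Finset.univ.filter fun g : K ≃ₐ[ℚ] K => embOf φ₀ g ∈ Φ.1) τ κ := by
    rw [hΦ]; exact hrG
  have hprim : ∀ φh : K →+* ℂ, IsPrimitive (ℂ ≃+* ℂ) Φ.1 φh := fun φh =>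
    (CyclicTwoOddPrimes.isPrimitive_iff (φ₀ := φ₀) Φ φh).2 hprim'
  have hrank : cmTypeRank Φ = (p - 1) * p + 2 := by
    rw [cmTypeRank_eq_typeRank_galType Φ φ₀, hΦ]; exact hrankG
  refine ⟨Φ, hprim, ?_, hrank, fun A ι θ hA => ⟨(isSimple_iff_isPrimitive hA φ₀).2 (hprim φ₀), dim_eq hK hA,
    exists_exceptional_of_hasConstantRows hp2 hρ hτ hκ hτκ hK hprim' hr' hA⟩⟩
  rw [not_isNondegenerate_iff hp2 hρ hτ hκ hτκ hK Φ]
  exact Or.inl hr'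

/-- **Such abelian varieties exist over `K`** (Shimura's existence theorem, tree `exists_isCMTypeRealisation`).
[cite: Dodson1987, Remark 4.5] [cite: Shimura1998, §6.2 Theorem 3] -/
theorem exists_realisation_exceptional (hp2 : p ≠ 2) (hρ : ∀ x, φ₀ (ρ x) = starRingEnd ℂ (φ₀ x))
    (hτ : orderOf τ = p) (hκ : orderOf κ = p) (hτκ : κ ∉ Subgroup.zpowers τ)
    (hK : Module.finrank ℚ K = 2 * p ^ 2) :
    ∃ (Φ : CMType K) (A : AbelianVariety ℂ) (ι : 𝓞 K →+* End A) (θ : K →+* Module.End ℂ (complexBetti A.X 1)),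
      IsCMTypeRealisation Φ A ι θ ∧ (∀ φh : K →+* ℂ, IsPrimitive (ℂ ≃+* ℂ) Φ.1 φh) ∧ ¬ IsNondegenerate Φ ∧
        cmTypeRank Φ = (p - 1) * p + 2 ∧ A.IsSimple ∧ A.dim = p ^ 2 ∧
          ∃ c : complexBetti A.X (2 * p), IsRationalClass c ∧ IsOfHodgeType (p ^ 2) A.X (2 * p) p p c ∧
            c ∉ divisorClassesSpan A.X (p ^ 2) p := by
  obtain ⟨Φ, hprim, hdeg, hrank, hall⟩ := exists_isPrimitive_not_isNondegenerate hp2 hρ hτ hκ hτκ hK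
  obtain ⟨A, ι, θ, hA⟩ := exists_isCMTypeRealisation Φ
  exact ⟨Φ, A, ι, θ, hA, hprim, hdeg, hrank, hall A ι θ hA⟩

end Existence

section CoordinateFree

open Literature.AlgebraicGeometry.ComplexMultiplication.CyclicTwoPower (exists_conj_gal)

variable {K : Type} [Field K] [NumberField K] [IsCMField K] [Normal ℚ K] {p : ℕ}

/-- **EVERY CM field, Galois over `ℚ` with COMMUTATIVE group of order `2p²` (`p` an odd prime; cyclic `⟨ρ⟩ × ℤ_{p²}`
or not `⟨ρ⟩ × ℤₚ²`), is the CM field of a SIMPLE abelian `p²`-fold of Kubota rank `(p − 1)p + 2` carrying a rational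
`(p,p)`-class outside `Dᵖ ⊗ ℂ`** — Dodson's Remark 4.5 ("the existence of simple Abelian varieties of dimension
`n = 18, 27, …` with rank `10`" is the analogous statement one level up) for both minimal groups of degree `p²`.
[cite: Dodson1987, Prop. 4.4 and Remark 4.5] [cite: Hazama2003CyclicCM, Rem. 4.10] [cite: Shimura1998, §6.2 Theorem 3] -/
theorem exists_realisation_exceptional_of_isMulCommutative [IsMulCommutative (K ≃ₐ[ℚ] K)] (hp : p.Prime)
    (hp2 : p ≠ 2) (hK : Module.finrank ℚ K = 2 * p ^ 2) :
    ∃ (Φ : CMType K) (A : AbelianVariety ℂ) (ι : 𝓞 K →+* End A) (θ : K →+* Module.End ℂ (complexBetti A.X 1)),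
      IsCMTypeRealisation Φ A ι θ ∧ (∀ φh : K →+* ℂ, IsPrimitive (ℂ ≃+* ℂ) Φ.1 φh) ∧ ¬ IsNondegenerate Φ ∧
        cmTypeRank Φ = (p - 1) * p + 2 ∧ A.IsSimple ∧ A.dim = p ^ 2 ∧
          ∃ c : complexBetti A.X (2 * p), IsRationalClass c ∧ IsOfHodgeType (p ^ 2) A.X (2 * p) p p c ∧
            c ∉ divisorClassesSpan A.X (p ^ 2) p := by
  haveI : Fact p.Prime := ⟨hp⟩
  obtain ⟨φ₀⟩ : Nonempty (K →+* ℂ) := inferInstance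
  obtain ⟨ρ, hρ⟩ := exists_conj_gal (K := K)
  by_cases hcyc : IsCyclic (K ≃ₐ[ℚ] K)
  · obtain ⟨σ, hσ⟩ := CyclicPrimeSquare.exists_orderOf_eq_sq (p := p) hcyc φ₀ hK
    exact CyclicPrimeSquare.exists_realisation_exceptional hp2 (hρ φ₀) hσ hK
  · obtain ⟨τ, κ, hτ, hκ, hτκ⟩ := exists_frame hp hp2 hcyc hK (hρ φ₀)
    exact exists_realisation_exceptional hp2 (hρ φ₀) hτ hκ hτκ hK

/-- **Dimension `9`**: every ABELIAN CM field of degree `18` is the CM field of a simple abelian `9`-fold of rank `8`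
with a rational `(3,3)`-class outside `D³ ⊗ ℂ`. [cite: Dodson1987, Prop. 4.4 and Remark 4.7] -/
theorem exists_realisation_exceptional_eighteen [IsMulCommutative (K ≃ₐ[ℚ] K)] (hK : Module.finrank ℚ K = 18) :
    ∃ (Φ : CMType K) (A : AbelianVariety ℂ) (ι : 𝓞 K →+* End A) (θ : K →+* Module.End ℂ (complexBetti A.X 1)),
      IsCMTypeRealisation Φ A ι θ ∧ cmTypeRank Φ = 8 ∧ A.IsSimple ∧ A.dim = 9 ∧
        ∃ c : complexBetti A.X 6, IsRationalClass c ∧ IsOfHodgeType 9 A.X 6 3 3 c ∧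
          c ∉ divisorClassesSpan A.X 9 3 := by
  obtain ⟨Φ, A, ι, θ, hA, -, -, hrank, hS, hd, hc⟩ :=
    exists_realisation_exceptional_of_isMulCommutative (K := K) Nat.prime_three (by norm_num) (by rw [hK]; norm_num)
  refine ⟨Φ, A, ι, θ, hA, by rw [hrank], hS, by rw [hd]; norm_num, ?_⟩
  norm_num at hc
  exact hc

end CoordinateFree

/-! ## §3 `p = 3`: the census of the `512` CM types of `K`, `Gal(K/ℚ) = ⟨ρ⟩ × ℤ₃²` -/

section Census

open Literature.AlgebraicGeometry.ComplexMultiplication.CyclicTwoPower (exists_conj_gal)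

variable {K : Type} [Field K] [NumberField K] [IsCMField K] [Normal ℚ K] [IsMulCommutative (K ≃ₐ[ℚ] K)]
variable {ρ τ κ : K ≃ₐ[ℚ] K} {φ₀ : K →+* ℂ}

/-- **THE CENSUS BY RANK for a CM field with Galois group `⟨ρ⟩ × ℤ₃²`**: of its `512` CM types, `342` have rank
`10` (nondegenerate), `144` rank `8`, none rank `6`, `24` rank `4`, `2` rank `2` (the cyclic fields `ℚ(ζ₁₉)`,
`ℚ(ζ₂₇)`: `450 / 54 / 0 / 6 / 2`). [cite: Dodson1987, Prop. 4.4 (2) and Remark 4.7] -/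
theorem ncard_cmTypeRank_eq_three (hρ : ∀ x, φ₀ (ρ x) = starRingEnd ℂ (φ₀ x)) (hτ : orderOf τ = 3)
    (hκ : orderOf κ = 3) (hτκ : κ ∉ Subgroup.zpowers τ) (hK : Module.finrank ℚ K = 18) :
    (Set.univ : Set (CMType K)).ncard = 512 ∧
    {Φ : CMType K | cmTypeRank Φ = 10}.ncard = 342 ∧ {Φ : CMType K | cmTypeRank Φ = 8}.ncard = 144 ∧
    {Φ : CMType K | cmTypeRank Φ = 6}.ncard = 0 ∧ {Φ : CMType K | cmTypeRank Φ = 4}.ncard = 24 ∧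
    {Φ : CMType K | cmTypeRank Φ = 2}.ncard = 2 ∧ {Φ : CMType K | IsNondegenerate Φ}.ncard = 342 := by
  have hK' : Module.finrank ℚ K = 2 * 3 ^ 2 := by rw [hK]; norm_num
  have hcardG : Fintype.card (K ≃ₐ[ℚ] K) = 18 := by rw [card_gal_eq φ₀ hK']; norm_num
  have hρ1 := conjGalElt_ne_one hρ
  have hρ2 := conjGalElt_mul_self hρ
  obtain ⟨h10, h8, h6, h4, h2⟩ := ncard_typeRank_eq_three hτ hκ hτκ hcardG hρ1 hρ2
  have hrk : ∀ n : ℕ, {Φ : CMType K | cmTypeRank Φ = n}.ncard =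
      {ΦG : Finset (K ≃ₐ[ℚ] K) | IsCMTypeWith ρ (ΦG : Set (K ≃ₐ[ℚ] K)) ∧
        typeRank (K ≃ₐ[ℚ] K) (ΦG : Set (K ≃ₐ[ℚ] K)) = n}.ncard := fun n =>
    ncard_cmType_sep_eq hρ _ _ fun Φ => by rw [cmTypeRank_eq_typeRank_galType Φ φ₀]
  refine ⟨?_, by rw [hrk, h10], by rw [hrk, h8], by rw [hrk, h6], by rw [hrk, h4], by rw [hrk, h2], ?_⟩
  · have h := ncard_cmType_sep_eq hρ (fun _ => True) (fun _ => True) fun _ => Iff.rfl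
    simp only [Set.setOf_true, and_true] at h
    rw [h, ncard_cmTypes_three hτ hκ hτκ hcardG hρ1 hρ2]
  · rw [← h10]
    refine ncard_cmType_sep_eq hρ _ _ fun Φ => ?_
    rw [_root_.Literature.AlgebraicGeometry.Pohlmann1968.isNondegenerate_iff, cmTypeRank_eq_typeRank_galType Φ φ₀, hK]

/-- **Prop. 4.4 (2) for `K`, with its numbers**: `K` has `84` CM types of weight `3` in the frame (three of the
nine `σ_{τˣκʸ}`); `72` of them are primitive (orbits of order `9`; rank `8`) and `12` are not ("twelve `f` in four
`ℤ₃²`-orbits of order `3`"). [cite: Dodson1987, Prop. 4.4 (2)] -/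
theorem ncard_weight_three_isPrimitive (hρ : ∀ x, φ₀ (ρ x) = starRingEnd ℂ (φ₀ x)) (hτ : orderOf τ = 3)
    (hκ : orderOf κ = 3) (hτκ : κ ∉ Subgroup.zpowers τ) (hK : Module.finrank ℚ K = 18) :
    {Φ : CMType K | (Finset.univ.filter fun xy : ZMod 3 × ZMod 3 => τ ^ xy.1.val * κ ^ xy.2.val ∈
        (Finset.univ.filter fun g : K ≃ₐ[ℚ] K => embOf φ₀ g ∈ Φ.1)).card = 3 ∧
      IsPrimitive (ℂ ≃+* ℂ) Φ.1 φ₀}.ncard = 72 ∧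
    {Φ : CMType K | (Finset.univ.filter fun xy : ZMod 3 × ZMod 3 => τ ^ xy.1.val * κ ^ xy.2.val ∈
        (Finset.univ.filter fun g : K ≃ₐ[ℚ] K => embOf φ₀ g ∈ Φ.1)).card = 3 ∧
      ¬ IsPrimitive (ℂ ≃+* ℂ) Φ.1 φ₀}.ncard = 12 := by
  have hK' : Module.finrank ℚ K = 2 * 3 ^ 2 := by rw [hK]; norm_num
  have hcardG : Fintype.card (K ≃ₐ[ℚ] K) = 18 := by rw [card_gal_eq φ₀ hK']; norm_num
  obtain ⟨h72, h12⟩ := ncard_weight_three hτ hκ hτκ hcardG (conjGalElt_ne_one hρ) (conjGalElt_mul_self hρ)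
  constructor
  · rw [← h72]
    refine ncard_cmType_sep_eq hρ _ _ fun Φ => ?_
    rw [CyclicTwoOddPrimes.isPrimitive_iff (φ₀ := φ₀) Φ φ₀]
  · rw [← h12]
    refine ncard_cmType_sep_eq hρ _ _ fun Φ => ?_
    rw [CyclicTwoOddPrimes.isPrimitive_iff (φ₀ := φ₀) Φ φ₀]
    simp only [not_forall, not_not, exists_prop]

/-- **ABELIAN CM fields of degree `18`: `54` or `144` primitive degenerate CM types (rank `8`), according as the
Galois group is cyclic (`ℚ(ζ₁₉)`, `ℚ(ζ₂₇)`) or not.** [cite: Dodson1987, Prop. 4.4 (1), (2)] -/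
theorem ncard_isPrimitive_not_isNondegenerate_eighteen (hK : Module.finrank ℚ K = 18) (φ₀ : K →+* ℂ) :
    {Φ : CMType K | IsPrimitive (ℂ ≃+* ℂ) Φ.1 φ₀ ∧ ¬ IsNondegenerate Φ}.ncard =
      if IsCyclic (K ≃ₐ[ℚ] K) then 54 else 144 := by
  have hK' : Module.finrank ℚ K = 2 * 3 ^ 2 := by rw [hK]; norm_num
  obtain ⟨ρ, hρ⟩ := exists_conj_gal (K := K)
  split_ifs with hcyc
  · obtain ⟨σ, hσ⟩ := CyclicPrimeSquare.exists_orderOf_eq_sq (p := 3) hcyc φ₀ hK'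
    rw [CyclicPrimeSquare.ncard_isPrimitive_not_isNondegenerate (by norm_num) (hρ φ₀) hσ hK']
    decide
  · obtain ⟨τ, κ, hτ, hκ, hτκ⟩ := exists_frame Nat.prime_three (by norm_num) hcyc hK' (hρ φ₀)
    obtain ⟨-, -, h8, -⟩ := ncard_cmTypeRank_eq_three (hρ φ₀) hτ hκ hτκ hK
    rw [← h8]
    congr 1
    ext Φ
    simp only [Set.mem_setOf_eq]
    constructor
    · rintro ⟨hprim, hnd⟩
      obtain ⟨h108, hiff⟩ := cmTypeRank_eq_or_of_isPrimitive_three (hρ φ₀) hτ hκ hτκ hK Φ hprim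
      exact h108.resolve_left fun h10 => hnd (hiff.2 h10)
    · intro h8Φ
      have hprim : IsPrimitive (ℂ ≃+* ℂ) Φ.1 φ₀ := by
        by_contra hnp
        rcases cmTypeRank_eq_or_of_not_isPrimitive (p := 3) (by norm_num) (hρ φ₀) hτ hκ hτκ hK' Φ hnp with
          h | h <;> omega
      refine ⟨hprim, fun hnd => ?_⟩
      rw [_root_.Literature.AlgebraicGeometry.Pohlmann1968.isNondegenerate_iff, hK] at hnd
      omega

end Census

end ElemPrimeSquare

end Literature.AlgebraicGeometry.Pohlmann1968
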